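import Summits.NavierStokesRegularity.FluidComputer.TubeTablePost13
import HarnessLib

/-!
# Kernel run of the post-ramp box tube, chunks 12 … 17 (bp3 gen 16)

HONEST FRAMING: low prior, high value-of-information experiment on Tao's machine paradigm; NOT a
claim that NS blows up.

Kernel evaluations (`decide +kernel`; no `native_decide`, no extra axioms) of the in-tree tube checker
`runTube` (`P = 60`, 12 Taylor terms, cube `Rt`, read-out `CLt`) on the chunks `cP13 12 … cP13 17`
(= design chunks `cT 25 … cT 30`) of `TubeTablePost13.lean`, each from the recorded boundary
state `sP13 i` to `sP13 (i+1)`.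

[cite: Tao2016AveragedNS, §5.5 Thm 5.3 (5.5)]
-/

namespace Summit.NavierStokesRegularity.FluidComputer

namespace TubeTablePost13

open Literature.Analysis.FluidPDE.FluidComputer Literature.Analysis.FluidPDE.FluidComputer.TubeTable
open Literature.Analysis.FluidPDE.FluidComputer.ThresholdLevelTable (GIt)

set_option maxHeartbeats 10000000 in
set_option maxRecDepth 200000 in
/-- Chunk 12 of the post-ramp tube run (design chunk 25: 50 steps at `h = 2^-11`). [folklore] -/
theorem runP13_12 : runTube 60 12 GIt CLt Rt (sP13 12) (cP13 12) = some (sP13 (12 + 1)) := by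
  decide +kernel

set_option maxHeartbeats 10000000 in
set_option maxRecDepth 200000 in
/-- Chunk 13 of the post-ramp tube run (design chunk 26: 50 steps at `h = 2^-11`). [folklore] -/
theorem runP13_13 : runTube 60 12 GIt CLt Rt (sP13 13) (cP13 13) = some (sP13 (13 + 1)) := by
  decide +kernel

set_option maxHeartbeats 10000000 in
set_option maxRecDepth 200000 in
/-- Chunk 14 of the post-ramp tube run (design chunk 27: 50 steps at `h = 2^-11`). [folklore] -/
theorem runP13_14 : runTube 60 12 GIt CLt Rt (sP13 14) (cP13 14) = some (sP13 (14 + 1)) := by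
  decide +kernel

set_option maxHeartbeats 10000000 in
set_option maxRecDepth 200000 in
/-- Chunk 15 of the post-ramp tube run (design chunk 28: 50 steps at `h = 2^-11`). [folklore] -/
theorem runP13_15 : runTube 60 12 GIt CLt Rt (sP13 15) (cP13 15) = some (sP13 (15 + 1)) := by
  decide +kernel

set_option maxHeartbeats 10000000 in
set_option maxRecDepth 200000 in
/-- Chunk 16 of the post-ramp tube run (design chunk 29: 50 steps at `h = 2^-11`). [folklore] -/
theorem runP13_16 : runTube 60 12 GIt CLt Rt (sP13 16) (cP13 16) = some (sP13 (16 + 1)) := by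
  decide +kernel

set_option maxHeartbeats 10000000 in
set_option maxRecDepth 200000 in
/-- Chunk 17 of the post-ramp tube run (design chunk 30: 50 steps at `h = 2^-11`). [folklore] -/
theorem runP13_17 : runTube 60 12 GIt CLt Rt (sP13 17) (cP13 17) = some (sP13 (17 + 1)) := by
  decide +kernel

end TubeTablePost13

end Summit.NavierStokesRegularity.FluidComputer
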